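import Summits.ResolutionOfSingularities.ResolutionOfSingularities.Theorems.PurelyInseparableDim4TschirnhausIsolation
import Summits.ResolutionOfSingularities.ResolutionOfSingularities.Theorems.PurelyInseparableDim4IsolatedCleaning
import Summits.ResolutionOfSingularities.ResolutionOfSingularities.Theorems.PurelyInseparableDim4ResConeTransport
import HarnessLib
import HarnessLib.Audit.Tags

/-!
# Purely inseparable four-folds — the DICTIONARY «Tschirnhaus jet ⟷ Hasse contact»: the `x_f^{d-1}`-row
# of `G(x_f + ψ, u)` is `h(ψ(u), u)` for `h := D_f^{(d-1)} G` (cell `res-dim4-pi`, K2(p) lane, brick (ii)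
# FILE D3)

[OURS · counted 0 · cell `res-dim4-pi` · brick (ii) «Tschirnhaus / W-frame infrastructure», FILE D3 (offer
of res-dim4-p-1 g3, bus 23:33:59Z), over FILE D (`…TschirnhausJet`), FILE C, B1/B2 (res-dim4-p-11 g2) and
the slice-B architecture memo `SLICE-B-ARCH-g3.md` §1 (res-dim4-p-12 g3: the polynomial Hasse contact
`h := D_f^{(d−1)} G`).]  Nothing here proves K2(p), `NoIsolatedTrap p p` or resolution of singularities in
dimension ≥ 4 / characteristic `p`.  AI kernel work, weaker than expert review.

Two objects of the lane describe the same hypersurface of maximal contact for a residual polynomial `G`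
with `in_d G = c·x_f^d`, `d < p`: FILE D's Tschirnhaus jets `φ_N(u)` (`x_f ↦ x_f + φ_N` kills the
`x_f^{d-1}·u^m`-coefficients, `|m| ≤ N`) and the slice-B memo's polynomial `h = D_f^{(d-1)} G` (the Hasse
derivative; `H = {h = 0}` is smooth at the origin with `∂h/∂x_f(0) = d·c ≠ 0`).  The dictionary:

* §1 `coeff_aeval_keep` — killing the outer variables `u_i`, `i ≠ f`, of `K[x][u]` does not change the
  coefficients of the pure powers `u_f^n` (tool, any coefficient ring).
* §2 **`hasseDeriv_single_frameChange`** — `D_f^{(n)}` COMMUTES with every `K`-algebra endomorphism `τ`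
  with `τ x_f = x_f + ψ`, `τ x_i = x_i` (`i ≠ f`), `ψ` free of `x_f` (Taylor morphism: `τ(x + u)` and
  `τ` applied coefficientwise to `x + u` differ only in the `u_i`, `i ≠ f`); `hasseDeriv_single_tsch` for
  FILE B's `tsch f φ`.
* §3 **`coeff_add_single_eq_coeff_killVar_hasseDeriv`** — the `x_f^j·u^m`-coefficient of `P` is the
  `u^m`-coefficient of `(D_f^{(j)} P)|_{x_f = 0}`; hence **`coeff_add_single_frameChange_eq`**: the
  `x_f^j`-row of `τ_ψ G` is `(D_f^{(j)}G)(ψ(u), u)` (`killVar_frameChange` : `(τ_ψ P)|_{x_f=0} = P(ψ(u), u)`),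
  and **`jet_iff_hasseContact`**: `φ` kills FILE D's `N`-jets iff `h(φ(u), u) ∈ (u)^{N+1}` — `φ_N` is the
  `N`-jet of the branch `x_f = θ(u)` of `H` through the origin (implicit function), unique by
  `hasseContact_jet_unique`.
* §4 **`exists_tsch_hasseContact`** — in the Tschirnhaus frame `tsch f φ_N` of FILE D the new contact
  polynomial `h̃ := D_f^{(d-1)}(tsch f φ_N G) = tsch f φ_N h` has `coeff_{x_f} h̃ = d·c ≠ 0` and NO `x_f`-free
  monomial of degree `≤ N`: `h̃ ≡ x_f·(d c + …)` modulo `x_f`-free terms of order `> N` — the memo's struck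
  sentence «in Tschirnhaus coordinates `h = v̄·unit`» made true AT THE JET LEVEL, the shape the «jets of
  `G` along `H`» of (K6)/(K7) can read.

What is NOT here: anything about blow-ups (the transport of `h` is typ-1 g2's `…HasseBlowupCommute` and
p-9 g3's K5), the ideal-membership ledgers (K4/K8), termination.
[cite: Abhyankar1990, Lecture 22 p.174 and p.186]; [cite: CossartPiltant2009, I.8.3.6];
[cite: EGAIV4, Thm. 16.11.2 and Prop. 16.8.8 (Hasse–Schmidt operators, functoriality)].
bears_on: LADDER-RESOLUTION:D157-DOOR2 (res-dim4-pi · K2(p) · brick (ii) FILE D3).  Supports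
stmt-ResolutionOfSingularities-16155 (helper).
-/

set_option linter.dupNamespace false -- mandated namespace of this single-conjunct summit

noncomputable section

namespace Summit.ResolutionOfSingularities.ResolutionOfSingularities.Theorems.PIDim4

namespace FrameChange

open MvPolynomial Finset
open Literature.AlgebraicGeometry.Resolution
open Literature.AlgebraicGeometry.Resolution.Hauser2010
open Literature.AlgebraicGeometry.Resolution.HauserPerlega2019

/-! ## 1. Killing the outer variables other than `u_f` -/

section Keep

variable {A : Type} [CommRing A]

/-- `Q − Q|_{u_i = 0 (i ≠ f)}` lies in the ideal `(u_i : i ≠ f)`. [folklore] -/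
theorem sub_aeval_keep_mem_span (f : Fin 4) (Q : MvPolynomial (Fin 4) A) :
    Q - aeval (fun i => if i = f then (X f : MvPolynomial (Fin 4) A) else 0) Q ∈
      Ideal.span ((X : Fin 4 → MvPolynomial (Fin 4) A) '' {i | i ≠ f}) := by
  rw [← Ideal.Quotient.eq]
  have h : (Ideal.Quotient.mkₐ A (Ideal.span ((X : Fin 4 → MvPolynomial (Fin 4) A) '' {i | i ≠ f}))).comp
        (AlgHom.id A _) =
      (Ideal.Quotient.mkₐ A (Ideal.span ((X : Fin 4 → MvPolynomial (Fin 4) A) '' {i | i ≠ f}))).comp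
        (aeval fun i => if i = f then (X f : MvPolynomial (Fin 4) A) else 0) := by
    refine MvPolynomial.algHom_ext fun i => ?_
    by_cases hi : i = f
    · rw [AlgHom.comp_apply, AlgHom.comp_apply, AlgHom.id_apply, aeval_X, if_pos hi, hi]
    · rw [AlgHom.comp_apply, AlgHom.comp_apply, AlgHom.id_apply, aeval_X, if_neg hi,
        Ideal.Quotient.mkₐ_eq_mk, map_zero, Ideal.Quotient.eq_zero_iff_mem]
      exact Ideal.subset_span ⟨i, hi, rfl⟩
  have h' := congrArg (fun L => L Q) h
  simpa using h'

/-- **Killing the `u_i`, `i ≠ f`, keeps the coefficients of the pure powers `u_f^n`** (indeed of every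
monomial supported on `{f}`). [folklore] -/
theorem coeff_aeval_keep (f : Fin 4) (Q : MvPolynomial (Fin 4) A) {m : Fin 4 →₀ ℕ}
    (hm : ∀ i, i ≠ f → m i = 0) :
    coeff m (aeval (fun i => if i = f then (X f : MvPolynomial (Fin 4) A) else 0) Q) = coeff m Q := by
  have h := sub_aeval_keep_mem_span f Q
  rw [MvPolynomial.mem_ideal_span_X_image] at h
  have h0 : coeff m (Q - aeval (fun i => if i = f then (X f : MvPolynomial (Fin 4) A) else 0) Q) = 0 := by
    by_contra hne
    obtain ⟨i, hi, hmi⟩ := h m (mem_support_iff.mpr hne)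
    exact hmi (hm i hi)
  rw [coeff_sub, sub_eq_zero] at h0
  exact h0.symm

end Keep

variable {K : Type} [Field K] {f : Fin 4} {φ : MvPolynomial (Fin 4) K}

/-! ## 2. `D_f^{(n)}` commutes with the moves `x_f ↦ x_f + ψ(u)` -/

/-- **`D_f^{(n)}(τ P) = τ(D_f^{(n)} P)`** for the tree's operator `Resolution.hasseDeriv`, for every
`K`-algebra endomorphism `τ` of `K[x₁..x₄]` with `τ x_f = x_f + ψ`, `τ x_i = x_i` (`i ≠ f`) and `ψ` free of
`x_f`.  Proof: the Taylor morphism of `τ P` and `τ` applied coefficientwise to the Taylor morphism of `P`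
agree after killing the outer variables `u_i`, `i ≠ f` (they differ by `ψ(x + u) − ψ(x) ∈ (u_i : i ≠ f)`),
and the coefficient of `u_f^n` does not see those.
[cite: EGAIV4, Prop. 16.8.8 (functoriality of differential operators)] [folklore] -/
theorem hasseDeriv_single_frameChange_lit (τ : MvPolynomial (Fin 4) K →ₐ[K] MvPolynomial (Fin 4) K)
    (f : Fin 4) (ψ : MvPolynomial (Fin 4) K) (hf : τ (X f) = X f + ψ) (hi : ∀ i, i ≠ f → τ (X i) = X i)
    (hψ : f ∉ ψ.vars) (n : ℕ) (P : MvPolynomial (Fin 4) K) :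
    Literature.AlgebraicGeometry.Resolution.hasseDeriv K (Finsupp.single f n) (τ P) =
      τ (Literature.AlgebraicGeometry.Resolution.hasseDeriv K (Finsupp.single f n) P) := by
  set κ : MvPolynomial (Fin 4) (MvPolynomial (Fin 4) K) →ₐ[MvPolynomial (Fin 4) K]
      MvPolynomial (Fin 4) (MvPolynomial (Fin 4) K) :=
    aeval fun i => if i = f then (X f : MvPolynomial (Fin 4) (MvPolynomial (Fin 4) K)) else 0 with hκ
  have hκC : ∀ a : MvPolynomial (Fin 4) K, κ (C a) = C a := fun a => by
    rw [hκ, algHom_C, MvPolynomial.algebraMap_eq]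
  have hκXf : κ (X f) = X f := by rw [hκ, aeval_X, if_pos rfl]
  have hκX : ∀ i, i ≠ f → κ (X i) = 0 := fun i hi => by rw [hκ, aeval_X, if_neg hi]
  -- `κ (ψ(x + u)) = ψ(x)`: `ψ` does not involve `x_f`
  have hκψ : κ (taylor K ψ) = C ψ := by
    have h := MvPolynomial.hom_congr_vars
      (f₁ := κ.toRingHom.comp (taylor K (σ := Fin 4)).toRingHom)
      (f₂ := (C : MvPolynomial (Fin 4) K →+* MvPolynomial (Fin 4) (MvPolynomial (Fin 4) K)))
      (p₁ := ψ) (p₂ := ψ) ?_ ?_ rfl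
    · simpa using h
    · refine RingHom.ext fun c => ?_
      simp only [RingHom.comp_apply, AlgHom.toRingHom_eq_coe, RingHom.coe_coe, taylor_C, hκC]
    · intro i hi _
      have hif : i ≠ f := fun h => hψ (h ▸ hi)
      simp only [RingHom.comp_apply, AlgHom.toRingHom_eq_coe, RingHom.coe_coe, taylor_X, map_add,
        hκC, hκX i hif, add_zero]
  have hτC : ∀ c : K, τ (C c) = C c := fun c => by rw [algHom_C, MvPolynomial.algebraMap_eq]
  have key : κ.toRingHom.comp ((taylor K (σ := Fin 4)).toRingHom.comp τ.toRingHom) =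
      κ.toRingHom.comp ((MvPolynomial.map τ.toRingHom).comp (taylor K (σ := Fin 4)).toRingHom) := by
    refine MvPolynomial.ringHom_ext (fun c => ?_) (fun i => ?_)
    · simp only [RingHom.comp_apply, AlgHom.toRingHom_eq_coe, RingHom.coe_coe, hτC, taylor_C, map_C,
        hκC]
    · by_cases hif : i = f
      · rw [hif]
        simp only [RingHom.comp_apply, AlgHom.toRingHom_eq_coe, RingHom.coe_coe, hf, map_add,
          taylor_X, map_C, map_X, hκC, hκXf, hκψ]
        ring
      · simp only [RingHom.comp_apply, AlgHom.toRingHom_eq_coe, RingHom.coe_coe, hi i hif, taylor_X,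
          map_add, map_C, map_X, hκC, hκX i hif]
  have key' := RingHom.congr_fun key P
  simp only [RingHom.comp_apply, AlgHom.toRingHom_eq_coe, RingHom.coe_coe] at key'
  have hs : ∀ i, i ≠ f → (Finsupp.single f n : Fin 4 →₀ ℕ) i = 0 := fun i hi => by
    rw [Finsupp.single_apply, if_neg (Ne.symm hi)]
  rw [hasseDeriv_apply, hasseDeriv_apply, ← coeff_aeval_keep f (taylor K (τ P)) hs,
    show MvPolynomial.aeval (fun i => if i = f then (X f : MvPolynomial (Fin 4) (MvPolynomial (Fin 4) K))
        else 0) (taylor K (τ P)) = κ (taylor K (τ P)) from rfl, key',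
    show κ ((MvPolynomial.map (τ : MvPolynomial (Fin 4) K →+* MvPolynomial (Fin 4) K)) (taylor K P)) =
      MvPolynomial.aeval (fun i => if i = f then (X f : MvPolynomial (Fin 4) (MvPolynomial (Fin 4) K))
        else 0) ((MvPolynomial.map (τ : MvPolynomial (Fin 4) K →+* MvPolynomial (Fin 4) K))
          (taylor K P)) from rfl,
    coeff_aeval_keep f _ hs, coeff_map, RingHom.coe_coe]

/-- **`D_f^{(n)}(τ P) = τ(D_f^{(n)} P)`** for the frame's `PIDim4.hasseDeriv` and every move
`x_f ↦ x_f + ψ(u)` (`ψ` free of `x_f`; no condition on `ψ(0)`). [cite: EGAIV4, Prop. 16.8.8] [folklore] -/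
theorem hasseDeriv_single_frameChange (τ : MvPolynomial (Fin 4) K →ₐ[K] MvPolynomial (Fin 4) K)
    (f : Fin 4) (ψ : MvPolynomial (Fin 4) K) (hf : τ (X f) = X f + ψ) (hi : ∀ i, i ≠ f → τ (X i) = X i)
    (hψ : f ∉ ψ.vars) (n : ℕ) (P : MvPolynomial (Fin 4) K) :
    hasseDeriv (Finsupp.single f n) (τ P) = τ (hasseDeriv (Finsupp.single f n) P) := by
  rw [Equimultiple.hasseDeriv_eq, Equimultiple.hasseDeriv_eq]
  exact hasseDeriv_single_frameChange_lit τ f ψ hf hi hψ n P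

/-- `D_f^{(n)}` commutes with FILE B's `tsch f φ` (`f ∉ vars φ`). [cite: EGAIV4, Prop. 16.8.8] [folklore] -/
theorem hasseDeriv_single_tsch (hφ : f ∉ φ.vars) (n : ℕ) (P : MvPolynomial (Fin 4) K) :
    hasseDeriv (Finsupp.single f n) (tsch f φ P) = tsch f φ (hasseDeriv (Finsupp.single f n) P) :=
  hasseDeriv_single_frameChange (tsch f φ) f φ (tsch_X_self f φ) (fun _ hi => tsch_X_of_ne φ hi) hφ n P

/-! ## 3. The `x_f^j`-row and the Hasse contact -/

/-- **The `x_f^j·u^m`-coefficient of `P` is the `u^m`-coefficient of `(D_f^{(j)} P)|_{x_f = 0}`**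
(`m_f = 0`; `C(j, j) = 1` and the other binomials are `C(m_i, 0) = 1`).
[cite: EGAIV4, Thm. 16.11.2] [folklore] -/
theorem coeff_add_single_eq_coeff_killVar_hasseDeriv (f : Fin 4) (j : ℕ) (P : MvPolynomial (Fin 4) K)
    {m : Fin 4 →₀ ℕ} (hm : m f = 0) :
    coeff (m + Finsupp.single f j) P =
      coeff m (PointBlowup.killVar f (hasseDeriv (Finsupp.single f j) P)) := by
  rw [ResCone.coeff_killVar, if_pos hm, IsolatedBand.coeff_hasseDeriv,
    Finset.prod_eq_one (fun i _ => ?_), one_mul]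
  by_cases hi : i = f
  · rw [hi, hm, Finsupp.single_eq_same, zero_add, Nat.choose_self, Nat.cast_one]
  · rw [Finsupp.single_apply, if_neg (Ne.symm hi), add_zero, Nat.choose_zero_right, Nat.cast_one]

/-- **Killing `x_f` after the move is the substitution `x_f ↦ ψ(u)`**: `(τ_ψ P)|_{x_f = 0} = P(ψ(u), u)`.
[folklore] -/
theorem killVar_frameChange (τ : MvPolynomial (Fin 4) K →ₐ[K] MvPolynomial (Fin 4) K)
    (f : Fin 4) (ψ : MvPolynomial (Fin 4) K) (hf : τ (X f) = X f + ψ) (hi : ∀ i, i ≠ f → τ (X i) = X i)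
    (hψ : f ∉ ψ.vars) (P : MvPolynomial (Fin 4) K) :
    PointBlowup.killVar f (τ P) = aeval (fun i => if i = f then ψ else X i) P := by
  classical
  have hkψ : PointBlowup.killVar f ψ = ψ :=
    ResCone.killVar_eq_self_of_free ((not_mem_vars_iff f ψ).mp hψ)
  have h : (PointBlowup.killVar f).comp τ = aeval fun i => if i = f then ψ else X i := by
    refine MvPolynomial.algHom_ext fun i => ?_
    by_cases hif : i = f
    · rw [hif, AlgHom.comp_apply, hf, map_add, aeval_X, if_pos rfl, hkψ]
      unfold PointBlowup.killVar
      rw [aeval_X, if_pos rfl, zero_add]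
    · rw [AlgHom.comp_apply, hi i hif, aeval_X, if_neg hif]
      unfold PointBlowup.killVar
      rw [aeval_X, if_neg hif]
  rw [← h, AlgHom.comp_apply]

/-- **The dictionary**: the `x_f^j·u^m`-coefficient of `τ_ψ G` is the `u^m`-coefficient of
`(D_f^{(j)} G)(ψ(u), u)`; for `j = d − 1` the right-hand side is the Hasse contact `h = D_f^{(d-1)} G` of
the slice-B memo evaluated on the graph `x_f = ψ(u)`. [cite: CossartPiltant2009, I.8.3.6] [folklore] -/
theorem coeff_add_single_frameChange_eq (τ : MvPolynomial (Fin 4) K →ₐ[K] MvPolynomial (Fin 4) K)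
    (f : Fin 4) (ψ : MvPolynomial (Fin 4) K) (hf : τ (X f) = X f + ψ) (hi : ∀ i, i ≠ f → τ (X i) = X i)
    (hψ : f ∉ ψ.vars) (j : ℕ) (G : MvPolynomial (Fin 4) K) {m : Fin 4 →₀ ℕ} (hm : m f = 0) :
    coeff (m + Finsupp.single f j) (τ G) =
      coeff m (aeval (fun i => if i = f then ψ else X i) (hasseDeriv (Finsupp.single f j) G)) := by
  rw [coeff_add_single_eq_coeff_killVar_hasseDeriv f j (τ G) hm,
    hasseDeriv_single_frameChange τ f ψ hf hi hψ j G, killVar_frameChange τ f ψ hf hi hψ]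

/-- **FILE D's jets ⟷ the Hasse contact**: a move `x_f ↦ x_f + φ(u)` (`φ` free of `x_f`) kills the
`x_f^{d-1}·u^m`-coefficients of `G` for `|m| ≤ N` iff `h(φ(u), u)` has no monomial of degree `≤ N`
(`h = D_f^{(d-1)} G`): the Tschirnhaus jet `φ_N` is the `N`-jet of the branch `x_f = θ(u)` of
`H = {h = 0}` through the origin. [cite: Abhyankar1990, Lecture 22 p.186] [folklore] -/
theorem jet_iff_hasseContact (τ : MvPolynomial (Fin 4) K →ₐ[K] MvPolynomial (Fin 4) K)
    (f : Fin 4) (φ : MvPolynomial (Fin 4) K) (hf : τ (X f) = X f + φ) (hi : ∀ i, i ≠ f → τ (X i) = X i)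
    (hφ : f ∉ φ.vars) (d N : ℕ) (G : MvPolynomial (Fin 4) K) :
    (∀ m : Fin 4 →₀ ℕ, m f = 0 → m.degree ≤ N →
        coeff (m + Finsupp.single f (d - 1)) (τ G) = 0) ↔
      ∀ m : Fin 4 →₀ ℕ, m f = 0 → m.degree ≤ N →
        coeff m (aeval (fun i => if i = f then φ else X i)
          (hasseDeriv (Finsupp.single f (d - 1)) G)) = 0 := by
  refine forall_congr' fun m => forall_congr' fun hm => forall_congr' fun _ => ?_
  rw [coeff_add_single_frameChange_eq τ f φ hf hi hφ (d - 1) G hm]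

/-- **The branch jet is unique**: two `x_f`-free `φ, ψ` with `φ(0) = ψ(0) = 0` such that `h(φ(u), u)` and
`h(ψ(u), u)` both have no monomial of degree `≤ N` (`h = D_f^{(d-1)} G`, `coeff_{x_f^d} G ≠ 0`, `d` a unit)
agree in all degrees `≤ N` (FILE D's `jet_unique` read through the dictionary).
[cite: Abhyankar1990, Lecture 22 p.174] [folklore] -/
theorem hasseContact_jet_unique (f : Fin 4) {d : ℕ} (hd : 1 ≤ d) (hdK : (d : K) ≠ 0)
    (G : MvPolynomial (Fin 4) K) (hc : coeff (Finsupp.single f d) G ≠ 0) {N : ℕ}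
    {φ ψ : MvPolynomial (Fin 4) K} (h0φ : constantCoeff φ = 0) (hφ : f ∉ φ.vars)
    (h0ψ : constantCoeff ψ = 0) (hψ : f ∉ ψ.vars)
    (hNφ : ∀ m : Fin 4 →₀ ℕ, m f = 0 → m.degree ≤ N →
      coeff m (aeval (fun i => if i = f then φ else X i)
        (hasseDeriv (Finsupp.single f (d - 1)) G)) = 0)
    (hNψ : ∀ m : Fin 4 →₀ ℕ, m f = 0 → m.degree ≤ N →
      coeff m (aeval (fun i => if i = f then ψ else X i)
        (hasseDeriv (Finsupp.single f (d - 1)) G)) = 0) :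
    ∀ m : Fin 4 →₀ ℕ, m.degree ≤ N → coeff m φ = coeff m ψ :=
  jet_unique f hd hdK G hc ((forall_support_iff f φ).mpr ⟨h0φ, hφ⟩)
    ((forall_support_iff f ψ).mpr ⟨h0ψ, hψ⟩) (tsch f φ) (tsch f ψ) (tsch_X_self f φ)
    (fun _ hi => tsch_X_of_ne φ hi) (tsch_X_self f ψ) (fun _ hi => tsch_X_of_ne ψ hi)
    ((jet_iff_hasseContact (tsch f φ) f φ (tsch_X_self f φ) (fun _ hi => tsch_X_of_ne φ hi) hφ d N
      G).mpr hNφ)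
    ((jet_iff_hasseContact (tsch f ψ) f ψ (tsch_X_self f ψ) (fun _ hi => tsch_X_of_ne ψ hi) hψ d N
      G).mpr hNψ)

/-! ## 4. The Hasse contact in the Tschirnhaus frame -/

/-- `coeff_{x_f} (D_f^{(d-1)} G) = d · coeff_{x_f^d} G` (`C(d, d−1) = d`). [cite: EGAIV4, Thm. 16.11.2]
[folklore] -/
theorem coeff_single_one_hasseDeriv {d : ℕ} (hd : 1 ≤ d) (f : Fin 4) (G : MvPolynomial (Fin 4) K) :
    coeff (Finsupp.single f 1) (hasseDeriv (Finsupp.single f (d - 1)) G) =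
      d * coeff (Finsupp.single f d) G := by
  obtain ⟨e, rfl⟩ : ∃ e, d = e + 1 := ⟨d - 1, (Nat.sub_add_cancel hd).symm⟩
  rw [Nat.add_sub_cancel, IsolatedBand.coeff_hasseDeriv,
    add_comm (Finsupp.single f 1) (Finsupp.single f e), ← Finsupp.single_add,
    Finset.prod_eq_single f (fun i _ hi => ?_) (fun h => absurd (Finset.mem_univ f) h)]
  · rw [Finsupp.single_eq_same, Finsupp.single_eq_same, add_comm 1 e, Nat.choose_succ_self_right]
  · rw [Finsupp.single_apply, if_neg (Ne.symm hi), Finsupp.single_apply, if_neg (Ne.symm hi),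
      Nat.choose_zero_right, Nat.cast_one]

/-- **The Hasse contact in the Tschirnhaus frame.**  `1 ≤ d` a unit of `K`, `c = coeff_{x_f^d} G ≠ 0`, no
`x_f^{d-1}`/`x_f^{d-1}x_i` monomials, `h := D_f^{(d-1)} G`.  For every `N` there is an admissible `φ`
(`φ(0) = 0`, `f ∉ vars φ`, `ord₀ φ ≥ 2`) such that, with `G̃ := tsch f φ G` and `h̃ := D_f^{(d-1)} G̃`:
`h̃ = tsch f φ h`, the `x_f^{d-1}·u^m`-coefficients of `G̃` vanish for `|m| ≤ N`,
`coeff_{x_f} h̃ = d·c ≠ 0`, and `h̃` has NO `x_f`-free monomial of degree `≤ N` —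
`h̃ ≡ x_f·(d c + …)` modulo `x_f`-free terms of order `> N`.
[cite: Abhyankar1990, Lecture 22 p.174 and p.186] [cite: CossartPiltant2009, I.8.3.6] [folklore] -/
theorem exists_tsch_hasseContact (f : Fin 4) {d : ℕ} (hd : 1 ≤ d) (hdK : (d : K) ≠ 0)
    (G : MvPolynomial (Fin 4) K) (hc : coeff (Finsupp.single f d) G ≠ 0)
    (hG : ∀ m : Fin 4 →₀ ℕ, m f = 0 → m.degree ≤ 1 → coeff (m + Finsupp.single f (d - 1)) G = 0)
    (N : ℕ) :
    ∃ φ : MvPolynomial (Fin 4) K, constantCoeff φ = 0 ∧ f ∉ φ.vars ∧ (2 : ℕ∞) ≤ ordZero φ ∧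
      hasseDeriv (Finsupp.single f (d - 1)) (tsch f φ G) =
        tsch f φ (hasseDeriv (Finsupp.single f (d - 1)) G) ∧
      (∀ n : Fin 4 →₀ ℕ, n f = d - 1 → n.degree ≤ N + (d - 1) → coeff n (tsch f φ G) = 0) ∧
      coeff (Finsupp.single f 1) (hasseDeriv (Finsupp.single f (d - 1)) (tsch f φ G)) =
        d * coeff (Finsupp.single f d) G ∧
      (d : K) * coeff (Finsupp.single f d) G ≠ 0 ∧
      ∀ m : Fin 4 →₀ ℕ, m f = 0 → m.degree ≤ N →
        coeff m (hasseDeriv (Finsupp.single f (d - 1)) (tsch f φ G)) = 0 := by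
  obtain ⟨φ, h0, hv, h2, hj⟩ := exists_tsch_jet f hd hdK G hc hG N
  have hsupp : ∀ a ∈ φ.support, a f = 0 ∧ 1 ≤ a.degree := (forall_support_iff f φ).mpr ⟨h0, hv⟩
  refine ⟨φ, h0, hv, h2, hasseDeriv_single_tsch hv (d - 1) G, hj, ?_, mul_ne_zero hdK hc,
    fun m hm hmN => ?_⟩
  · rw [coeff_single_one_hasseDeriv hd, coeff_single_frameChange (tsch f φ) f φ (tsch_X_self f φ)
      (fun _ hi => tsch_X_of_ne φ hi) hsupp G d]
  · -- an `x_f`-free coefficient of `h̃` is an `x_f^{d-1}`-row coefficient of `G̃`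
    have hrow := coeff_add_single_eq_coeff_killVar_hasseDeriv f (d - 1) (tsch f φ G) hm
    rw [ResCone.coeff_killVar, if_pos hm] at hrow
    rw [← hrow]
    refine hj _ ?_ ?_
    · rw [Finsupp.add_apply, hm, Finsupp.single_eq_same, zero_add]
    · rw [map_add, Finsupp.degree_single]
      omega

end FrameChange

end Summit.ResolutionOfSingularities.ResolutionOfSingularities.Theorems.PIDim4

end
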